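import Summits.CriticalPhenomena.PercolationContinuityZ3.Theorems.Transplant.FKConnectivityAllQPat3ShapeTwoTab
import HarnessLib

/-!
# Connectivity correlation inequalities for `φ_{w,q}`, every `q > 0` — CELL-WISE verification of coefficient literals (all levels of a
# cell in ONE fold over the skeleton colourings; census g40) and the two-piece cells

Definitions + theorems file (`--supports stmt-CriticalPhenomena-4575`), census lineage (gen 40) of LANE 2's FK sub-programme; builds on
p205010 (kernel theorem, internal audit signed; external expert review pending).  No named facts, no sorries; standard axioms.

WHY: verifying a coefficient literal level by level (`FK.coefCheck2`, `FK.coefRows3`) re-reads the side table once per level; folding the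
`2^e` colourings of a cell ONCE into a level vector (`FK.addAt2`) and comparing the literal's column as a whole list is ≈ 4× cheaper in the
kernel and — split into units — bounded in memory (MEASURED, census g40: EEE-triangle 5 units ≈ 115 s vs 420 s; W₄ leaves with 32/64
colourings need the finer units).
* `FK.sumBits_eq_sum_allBits`; `FK.addAt1`, `FK.addAt2` (+ `length_…`, `…_getD`); **`FK.foldVec nd ts`** (fold the contributions `(k, a, b)`:
  `a` at level `k`, `b` at `k + 1`) and **`FK.foldVec_getD`**;
* two pieces: `FK.cellTerms2`, `FK.cellLit2`, **`FK.coefCells2`** (unit = first pattern `P1`) and **`FK.coefCheck2_of_cells`** (the five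
  units give `FK.coefCheck2`).  The three-piece cells are in `…Pat3ShapeThreeTab.lean`.
[cite: AyyerLinussonRavichandran2025, §7 (p. 22)]
-/

namespace Summit.CriticalPhenomena.PercolationContinuityZ3.Theorems

namespace FK

open SimpleGraph Literature.Probability.LatticeModels Literature.Probability.Percolation
open scoped Classical

variable {V : Type*}

/-! ### Cell-wise (all levels in ONE pass over the colourings) verification of coefficient literals (census g40): the generic
fold `FK.foldVec` and the two-piece cells `FK.coefCells2` (unit of kernel evaluation = one second-piece... first pattern `P1`) -/

section CellVec

/-- `FK.sumBits` is the sum over `FK.allBits`. [folklore] -/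
theorem sumBits_eq_sum_allBits (n : ℕ) (f : List Bool → ℤ) : sumBits n f = ((allBits n).map f).sum := by
  induction n generalizing f with
  | zero => simp [sumBits, allBits]
  | succ n ih =>
    show sumBits n (fun bs => f (false :: bs)) + sumBits n (fun bs => f (true :: bs)) = _
    rw [ih, ih]
    simp only [allBits, List.map_append, List.map_map, List.sum_append]
    rfl

/-- Add `b` to the head of an integer vector (no-op on the empty vector). [folklore] -/
def addAt1 : List ℤ → ℤ → List ℤ
  | [], _ => []
  | y :: ys, b => (y + b) :: ys

/-- Add `a` at index `k` and `b` at index `k + 1` of an integer vector (entries beyond the end are dropped). [folklore] -/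
def addAt2 : List ℤ → ℕ → ℤ → ℤ → List ℤ
  | [], _, _, _ => []
  | x :: xs, 0, a, b => (x + a) :: addAt1 xs b
  | x :: xs, k + 1, a, b => x :: addAt2 xs k a b

/-- `FK.addAt1` keeps the length. [folklore] -/
theorem length_addAt1 (v : List ℤ) (b : ℤ) : (addAt1 v b).length = v.length := by
  cases v <;> rfl

/-- `FK.addAt2` keeps the length. [folklore] -/
theorem length_addAt2 (v : List ℤ) (k : ℕ) (a b : ℤ) : (addAt2 v k a b).length = v.length := by
  induction v generalizing k with
  | nil => rfl
  | cons x xs ih =>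
    cases k with
    | zero => simp only [addAt2, List.length_cons, length_addAt1]
    | succ k => simp only [addAt2, List.length_cons, ih]

/-- Reading `FK.addAt1`. [folklore] -/
theorem addAt1_getD (v : List ℤ) (b : ℤ) (d : ℕ) (hd : d < v.length) :
    (addAt1 v b).getD d 0 = v.getD d 0 + (if 0 = d then b else 0) := by
  cases v with
  | nil => simp at hd
  | cons y ys =>
    cases d with
    | zero => simp [addAt1]
    | succ d => simp [addAt1]

/-- Reading `FK.addAt2` inside the vector. [folklore] -/
theorem addAt2_getD (v : List ℤ) (k : ℕ) (a b : ℤ) (hk : k + 1 < v.length) (d : ℕ) (hd : d < v.length) :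
    (addAt2 v k a b).getD d 0 = v.getD d 0 + (if k = d then a else 0) + (if k + 1 = d then b else 0) := by
  induction v generalizing k d with
  | nil => simp at hd
  | cons x xs ih =>
    cases k with
    | zero =>
      cases d with
      | zero => simp [addAt2]
      | succ d =>
        simp only [addAt2, List.getD_cons_succ, List.length_cons] at hk ⊢
        rw [addAt1_getD xs b d (by simp at hd; omega)]
        by_cases h : d = 0
        · subst h; simp
        · simp [h, show ¬ 0 = d from fun e => h e.symm]
    | succ k =>
      cases d with
      | zero => simp [addAt2]
      | succ d =>
        simp only [addAt2, List.getD_cons_succ, List.length_cons] at hk hd ⊢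
        rw [ih k (by omega) d (by omega)]
        simp only [Nat.succ.injEq]

/-- **Fold a list of two-level contributions `(k, a, b)`** (`a` at level `k`, `b` at level `k + 1`) into a vector of length `nd`.
[folklore] -/
def foldVec (nd : ℕ) (ts : List (ℕ × ℤ × ℤ)) : List ℤ :=
  ts.foldl (fun acc t => addAt2 acc t.1 t.2.1 t.2.2) ((List.range nd).map fun _ => 0)

/-- Reading the folded vector: the sum of the contributions at level `d` (all level indices in range). [folklore] -/
theorem foldVec_getD {nd : ℕ} {ts : List (ℕ × ℤ × ℤ)} (hk : ∀ t ∈ ts, t.1 + 1 < nd) {d : ℕ} (hd : d < nd) :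
    (foldVec nd ts).getD d 0 = (ts.map fun t => (if t.1 = d then t.2.1 else 0) + (if t.1 + 1 = d then t.2.2 else 0)).sum := by
  unfold foldVec
  have inv : ∀ (l : List (ℕ × ℤ × ℤ)) (acc : List ℤ), (∀ t ∈ l, t.1 + 1 < nd) → acc.length = nd →
      (l.foldl (fun acc t => addAt2 acc t.1 t.2.1 t.2.2) acc).getD d 0 =
        acc.getD d 0 + (l.map fun t => (if t.1 = d then t.2.1 else 0) + (if t.1 + 1 = d then t.2.2 else 0)).sum := by
    intro l
    induction l with
    | nil => intro acc _ _; simp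
    | cons t l ih =>
      intro acc hl hacc
      rw [List.foldl_cons, ih _ (fun t' h' => hl t' (by simp [h'])) (by rw [length_addAt2, hacc]),
        addAt2_getD acc _ _ _ (by rw [hacc]; exact hl t (by simp)) d (by rw [hacc]; exact hd)]
      simp only [List.map_cons, List.sum_cons]
      ring
  rw [inv ts _ hk (by rw [List.length_map, List.length_range])]
  rw [List.getD_eq_getElem?_getD, List.getElem?_map, List.getElem?_range hd, Option.map_some, Option.getD_some, zero_add]

/-- The two-level contributions of the colourings at one two-piece cell. [folklore] -/
def cellTerms2 (n : ℕ) (S : List (List (List (Pat3 × ℕ)))) (F : ℕ → Pat3 → Pat3 → ℤ) (P1 Q1 P2 Q2 : Pat3) : List (ℕ × ℤ × ℤ) :=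
  (allBits n).map fun bs =>
    ((sideGet2 S bs P1 P2).2 + (sideGet2 S (bs.map (! ·)) Q1 Q2).2,
      F 0 (sideGet2 S bs P1 P2).1 (sideGet2 S (bs.map (! ·)) Q1 Q2).1,
      F 1 (sideGet2 S bs P1 P2).1 (sideGet2 S (bs.map (! ·)) Q1 Q2).1)

/-- The two-piece literal's column at one cell. [folklore] -/
def cellLit2 (T : List (List (List (List (List ℤ))))) (nd : ℕ) (P1 Q1 P2 Q2 : Pat3) : List ℤ :=
  (List.range nd).map fun d => coefGet2 T d P1 Q1 P2 Q2

/-- **Cell-wise two-piece coefficient check** at the first pattern `P1` (unit of kernel evaluation). [folklore] -/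
def coefCells2 (nd n : ℕ) (S : List (List (List (Pat3 × ℕ)))) (F : ℕ → Pat3 → Pat3 → ℤ) (T : List (List (List (List (List ℤ)))))
    (P1 : Pat3) : Bool :=
  Pat3.list.all fun Q1 => Pat3.list.all fun P2 => Pat3.list.all fun Q2 =>
    ((cellTerms2 n S F P1 Q1 P2 Q2).all fun t => decide (t.1 + 1 < nd)) &&
      decide (cellLit2 T nd P1 Q1 P2 Q2 = foldVec nd (cellTerms2 n S F P1 Q1 P2 Q2))

/-- The two-piece coefficient-table check from its five cell-wise units. [folklore] -/
theorem coefCheck2_of_cells {nd n : ℕ} {S : List (List (List (Pat3 × ℕ)))} {F : ℕ → Pat3 → Pat3 → ℤ}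
    {T : List (List (List (List (List ℤ))))} (h : ∀ P1 : Pat3, coefCells2 nd n S F T P1 = true) :
    coefCheck2 n S F T nd = true := by
  unfold coefCheck2
  simp only [List.all_eq_true, decide_eq_true_eq]
  intro d hd P1 _ Q1 _ P2 _ Q2 _
  rw [List.mem_range] at hd
  have h1 := h P1
  unfold coefCells2 at h1
  simp only [List.all_eq_true, Bool.and_eq_true, decide_eq_true_eq] at h1
  obtain ⟨hk, heq⟩ := h1 Q1 Q1.mem_list P2 P2.mem_list Q2 Q2.mem_list
  have e1 : (cellLit2 T nd P1 Q1 P2 Q2).getD d 0 = coefGet2 T d P1 Q1 P2 Q2 := by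
    unfold cellLit2
    rw [List.getD_eq_getElem?_getD, List.getElem?_map, List.getElem?_range hd, Option.map_some, Option.getD_some]
  rw [← e1, heq, foldVec_getD hk hd]
  unfold coefSide2 cellTerms2
  rw [sumBits_eq_sum_allBits, List.map_map]
  rfl

end CellVec

end FK

end Summit.CriticalPhenomena.PercolationContinuityZ3.Theorems
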